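/-
Copyright (c) 2026. All rights reserved.
Released under Apache 2.0 license as described in the file LICENSE.
Authors: abc-iut cell — seat abc-iut-w5-d053 (gen 3; L4-lead row «Cor36-K-STEP3»), over the blueprint and
part 1 (`FrobeniusPictureMLFLogGlueFamilyEta.lean`, p430476) of seat abc-iut-L4-t5 (gen 4).
-/
import Literature.AnabelianGeometry.AbsoluteAnabelian.AbsTopIII.FrobeniusPictureMLFLogGlueFamilyEta

/-!
# [AbsTopIII] Cor 3.6 (iii): the MASTER FAMILY of homotopies on `𝒟` (part 2) — whisker law, `glueFamily`,
# `𝔖_log`-compatibility, cores, and the cores clause REDUCED to the cross-term gluing identity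

S. Mochizuki, *Topics in Absolute Anabelian Geometry III*, Cor. 3.6 (iii) pp. 80–81, Def. 3.5 (ii) p. 75
(kurims manuscript `paper:url-5493eb38cbb7`; bib key `MochizukiAbsTopIII2015`): "the family of homotopies that
constitutes `𝔖_log` is compatible with the families of homotopies that constitute the core [...] structures of (i)"
— typed by abc-iut-L4-t5 as `LogFrobeniusData.LogObsCompatCoresStmt` (`FrobeniusPictureMLFCompatibility.lean`):
ONE family `K` of homotopies on `𝒟` containing (Def. 3.5 (ii), along the embeddings) the `𝔖_log` family on
`𝒟_{≤3}` and core families for `(𝒟_{≤4}, ℰ)`, `(𝒟_{≤5}, Anab)`, `(𝒟_{≤6}, ℰ)`.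

Blueprint `HOME/staging/L4/L4-t5/DISCHARGE-PLAN-Cor36-compat.md` (abc-iut-L4-t5); landed steps: p425459 (transport,
reductions), p427618 (`coresFamily` = K₀), p427815 (`GlueE = E_W ∪ E_log`, saturated), p430476 = part 1 (`pushLogη`,
`glueη`, identity and composition laws).  This file (two sections, kept together so that ONE olean serves the
cross-term sequel):

* §2 the WHISKER law `glueη_whisker` (Def. 3.5 (ii): `ζ_{(γ₃∘γ∘γ₄, γ₃∘γ'∘γ₄)} = 𝒟_{γ₄} ◁ ζ ▷ 𝒟_{γ₃}`): pairs
  into rows 4–6 by `coresFamily.η_whisker`; pairs into `𝒩` with right whisker `𝒩 → 𝒩` (necessarily the empty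
  path) by the `𝔖_log` family's own whisker law read on `𝒟` through `𝒟_{≤3} = embLog^*𝒟` (`pushLogη_precomp`,
  `glueη_mapPath` — the glued homotopy on the image of a `𝒟_{≤3}`-pair IS the pushed-forward `𝔖_log` homotopy —,
  `glueη_whisker_mapPath`; endpoints cased so that lifts reduce, paths rewritten as `embLog`-images); the CROSS
  TERM — a log pair post-whiskered through `𝒩 → ℰ` into a core vertex — is the HYPOTHESIS `hcross`, stated inline
  (no new `Prop` definition; it is abc-iut-L4-t5 gen 5's row «Cor36-CROSS»).
* §3 `glueFamily H₃ hgen hcross : Δ.diagram.HomotopyFamily` (the master family: `E := GlueE`, `η := glueη`);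
  `compatibleAlong_embLog_glueFamily` (the `𝔖_log` family `H₃` ITSELF is compatible with it along `𝒟_{≤3} ↪ 𝒟`:
  `E ⊆ E_K`, same homotopies heterogeneously); the three core structures at the boundary-set level (abc-iut-L4-t5's
  `CoresCompatible` pattern); and **`logObsCompatCoresStmt_of_glueCross : IsLogObservableFamily H₃ → hcross →
  Δ.LogObsCompatCoresStmt`** — Cor 3.6 (iii), cores clause, REDUCED to the single cross-term identity (an `𝔖_log`
  family exists for every `𝒟`: abc-iut-w4-d095's `observableLogStmt`).

HONEST SCOPE: `hcross` is NOT discharged here; its content is `IotaOverGaloisStmt` (F-0360, PROVED AT THE MODEL by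
`TFModel.iotaOverGaloisStmt_model`) on the type-(1)/(2) generators, extended over `Sat(LogGen)` by induction.  Method
note: in these categories `simp` cannot fire `Category.comp_id` / `Functor.map_id` on the composites (instance-path
mismatch), so every `eqToHom` computation is a GENERIC lemma (all identifications variables, closed by `subst` +
`simp` + `conj_eqToHom_iff_heq'`) applied by `exact`.  No claim of the paper is asserted beyond the conditional
reduction; refereed pre-IUT material; nothing here bears on [IUTchIII] Cor. 3.12; typed ≠ discharged.
-/

/-! ## §2 (abc-iut-w5-d053, gen 3): the whisker law -/

namespace Literature.AnabelianGeometry.AbsoluteAnabelian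

open _root_.CategoryTheory _root_.Quiver

universe u

namespace LogFrobeniusData

open DiagramOfCategories

variable (Δ : LogFrobeniusData.{u})

/-- `eqToHom` bookkeeping: whiskering an `eqToHom`-sandwich on the left is an `eqToHom`-sandwich of the
whiskering (generic; applied by `exact`). [folklore] -/
private theorem whiskerLeft_sandwich {A B C : Type*} [Category A] [Category B] [Category C]
    (F : A ⥤ B) {G G' H H' : B ⥤ C} (h₁ : G = G') (α : G' ⟶ H') (h₂ : H' = H) :
    Functor.whiskerLeft F (eqToHom h₁ ≫ α ≫ eqToHom h₂) =
      eqToHom (by rw [h₁]) ≫ Functor.whiskerLeft F α ≫ eqToHom (by rw [h₂]) := by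
  subst h₁; subst h₂; simp

/-- `eqToHom` bookkeeping: re-associating a double `eqToHom`-sandwich (generic; applied by `exact`).
[folklore] -/
private theorem sandwich_sandwich {C : Type*} [Category C] {a a₁ a₂ b b₁ b₂ : C} (M : a₂ ⟶ b₂)
    (h₁ : a = a₁) (h₂ : a₁ = a₂) (h₃ : b₂ = b₁) (h₄ : b₁ = b)
    (k₁ : a = a₂) (k₂ : b₂ = b) :
    eqToHom h₁ ≫ (eqToHom h₂ ≫ M ≫ eqToHom h₃) ≫ eqToHom h₄ = eqToHom k₁ ≫ M ≫ eqToHom k₂ := by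
  subst h₁; subst h₂; subst h₃; subst h₄; simp

/-- `eqToHom` bookkeeping for the whisker law with trivial right whisker: generic functors, all the
identifications are variables that get substituted (applied by `exact`). [folklore] -/
private theorem whisker_nil_sandwich {A B C : Type*} [Category A] [Category B] [Category C]
    {F₁ F₂ : A ⥤ B} (hF : F₁ = F₂) {G G' H H' : B ⥤ C} (hG : G' = G) (hH : H = H') (η : G ⟶ H)
    {I : C ⥤ C} (hI : I = 𝟭 C) {X M₁ M₂ Y : A ⥤ C}
    (e₁ : X = M₁) (e₂ : M₁ = F₁ ⋙ (G ⋙ I)) (e₃ : F₁ ⋙ (H ⋙ I) = M₂) (e₄ : M₂ = Y)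
    (e₅ : X = F₂ ⋙ G') (e₆ : F₂ ⋙ H' = Y) :
    eqToHom e₁ ≫ (eqToHom e₂ ≫ Functor.whiskerLeft F₁ (Functor.whiskerRight η I) ≫ eqToHom e₃) ≫ eqToHom e₄ =
      eqToHom e₅ ≫ Functor.whiskerLeft F₂ (eqToHom hG ≫ η ≫ eqToHom hH) ≫ eqToHom e₆ := by
  subst hF hG hH hI e₁ e₂ e₄ e₃
  ext x
  simp
  exact (conj_eqToHom_iff_heq' _ _ _ _).mpr HEq.rfl

/-- **The pushed-forward `𝔖_log` homotopy, pre-whiskered** (Def. 3.5 (ii) whisker law on `𝒟_{≤3}`, read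
on `𝒟` through `𝒟_{≤3} = embLog^*𝒟`): for `r : c₀ → a₀` and a pair `(p, q) ∈ E_{H₃}`,
`ζ_{(r∘p, r∘q)} = 𝒟_{r} ◁ ζ_{(p,q)}` up to the `eqToHom`s of `pathFunctor_comp`.
[cite: MochizukiAbsTopIII2015, Definition 3.5 (ii) p.75] -/
theorem pushLogη_precomp (H₃ : Δ.sub3.HomotopyFamily) {c₀ a₀ b₀ : logObsShape.{u}.Vertex}
    (r : Path c₀ a₀) {p q : Path a₀ b₀} (h : H₃.E p q) :
    Δ.pushLogη H₃ (H₃.isSaturated.precomp h r) =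
      eqToHom (by rw [Prefunctor.mapPath_comp, pathFunctor_comp]) ≫
        Functor.whiskerLeft (Δ.diagram.pathFunctor (embLog.mapPath r)) (Δ.pushLogη H₃ h) ≫
        eqToHom (by rw [Prefunctor.mapPath_comp, pathFunctor_comp]) := by
  unfold pushLogη
  have hw := (Δ.sub3_eq_comapAlong ▸ H₃).η_whisker
    ((HomotopyFamily.cast_E_iff Δ.sub3_eq_comapAlong H₃ p q).mpr h) r Path.nil
  -- the whiskered pair `(r ∘ (p ∘ nil), r ∘ (q ∘ nil))` is `(r ∘ p, r ∘ q)` and the proof of membership is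
  -- irrelevant, so `hw` rewrites the middle term
  erw [hw]
  exact whisker_nil_sandwich (Δ.diagram.pathFunctor_comapAlong embLog r) _ _ _
    ((Δ.diagram.comapAlong embLog).pathFunctor_nil b₀) _ _ _ _ _ _

/-- Re-indexing a pushed-forward `𝔖_log` homotopy along equal pairs of `𝒟_{≤3}`-paths.
[cite: MochizukiAbsTopIII2015, Definition 3.5 (ii) p.75] -/
theorem pushLogη_congr (H₃ : Δ.sub3.HomotopyFamily) {a₀ b₀ : logObsShape.{u}.Vertex}
    {p₁ p₂ q₁ q₂ : Path a₀ b₀} (hp : p₁ = p₂) (hq : q₁ = q₂) (h₁ : H₃.E p₁ q₁) (h₂ : H₃.E p₂ q₂) :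
    Δ.pushLogη H₃ h₁ = eqToHom (by rw [hp]) ≫ Δ.pushLogη H₃ h₂ ≫ eqToHom (by rw [hq]) := by
  subst hp hq
  simp

/-- `eqToHom` bookkeeping for `glueη_mapPath`: the sandwich of the pushed-forward homotopy of the LIFTED
pair is the pushed-forward homotopy of the pair (the lifts being equal to the pair; applied by `exact`).
[cite: MochizukiAbsTopIII2015, Corollary 3.6 (iii) p.81] -/
private theorem sandwich_pushLogη_eq (H₃ : Δ.sub3.HomotopyFamily) {a₀ b₀ : logObsShape.{u}.Vertex}
    {p p' q q' : Path a₀ b₀} (hp : p' = p) (hq : q' = q) (h₀ : H₃.E p' q') (hh : H₃.E p q)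
    (e₁ : Δ.diagram.pathFunctor (embLog.mapPath p) = Δ.diagram.pathFunctor (embLog.mapPath p'))
    (e₂ : Δ.diagram.pathFunctor (embLog.mapPath q') = Δ.diagram.pathFunctor (embLog.mapPath q)) :
    eqToHom e₁ ≫ Δ.pushLogη H₃ h₀ ≫ eqToHom e₂ = Δ.pushLogη H₃ hh := by
  subst hp hq
  simp

/-- **The glued homotopy on the image of a `𝒟_{≤3}`-pair IS the pushed-forward `𝔖_log` homotopy** (the
lift of `embLog[p]` is `p`). [cite: MochizukiAbsTopIII2015, Corollary 3.6 (iii) p.81] -/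
theorem glueη_mapPath (H₃ : Δ.sub3.HomotopyFamily) (hgen : HomotopyFamily.IsGeneratedBy _ H₃ Δ.LogGen)
    {a₀ : logObsShape.{u}.Vertex} (p q : Path a₀ lvObs)
    (h : Δ.GlueE (embLog.mapPath p) (embLog.mapPath q)) (hh : H₃.E p q) :
    Δ.glueη H₃ hgen h = Δ.pushLogη H₃ hh := by
  rcases a₀ with ⟨v, hv⟩ | _
  · rcases v with n | _ | _ | _ | _ | _
    · exact Δ.sandwich_pushLogη_eq H₃ (eq_of_heq (liftLogPath_mapPath.{u} p le_rfl))
        (eq_of_heq (liftLogPath_mapPath.{u} q le_rfl)) _ hh _ _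
    · exact Δ.sandwich_pushLogη_eq H₃ (eq_of_heq (liftLogPath_mapPath.{u} p le_rfl))
        (eq_of_heq (liftLogPath_mapPath.{u} q le_rfl)) _ hh _ _
    · exact absurd hv (by simp [LFVertex.row])
    · exact absurd hv (by simp [LFVertex.row])
    · exact absurd hv (by simp [LFVertex.row])
    · exact absurd hv (by simp [LFVertex.row])
  · exact Δ.sandwich_pushLogη_eq H₃ (eq_of_heq (liftLogPath_mapPath.{u} p le_rfl))
      (eq_of_heq (liftLogPath_mapPath.{u} q le_rfl)) _ hh _ _

/-- Re-indexing a glued homotopy along equal pairs of paths. [cite: MochizukiAbsTopIII2015, Definition 3.5 (ii) p.75] -/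
theorem glueη_congr (H₃ : Δ.sub3.HomotopyFamily) (hgen : HomotopyFamily.IsGeneratedBy _ H₃ Δ.LogGen)
    {a b : LFVertex} {P₁ P₂ Q₁ Q₂ : Path a b} (hP : P₁ = P₂) (hQ : Q₁ = Q₂) (h₁ : Δ.GlueE P₁ Q₁)
    (h₂ : Δ.GlueE P₂ Q₂) :
    Δ.glueη H₃ hgen h₁ = eqToHom (by rw [hP]) ≫ Δ.glueη H₃ hgen h₂ ≫ eqToHom (by rw [hQ]) := by
  subst hP hQ
  simp

/-- `eqToHom` bookkeeping for the log case of the whisker law: generic functors, the three inputs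
(re-indexing, image = push-forward, push-forward pre-whiskered) as hypotheses (applied by `exact`). [folklore] -/
private theorem whisker_log_case {A B C : Type*} [Category A] [Category B] [Category C]
    (F : A ⥤ B) {G H : B ⥤ C} {η ηpush : G ⟶ H} (hη : η = ηpush) {I : C ⥤ C} (hI : I = 𝟭 C)
    {G₁ G₂ H₁ H₂ : A ⥤ C} {M : G₂ ⟶ H₂} {L : G₁ ⟶ H₁}
    {a₁ : G₁ = G₂} {a₂ : H₂ = H₁} (hL : L = eqToHom a₁ ≫ M ≫ eqToHom a₂)
    {b₁ : G₂ = F ⋙ G} {b₂ : F ⋙ H = H₂} (hM : M = eqToHom b₁ ≫ Functor.whiskerLeft F ηpush ≫ eqToHom b₂)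
    (X : G₁ = F ⋙ (G ⋙ I)) (Y : F ⋙ (H ⋙ I) = H₁) :
    L = eqToHom X ≫ Functor.whiskerLeft F (Functor.whiskerRight η I) ≫ eqToHom Y := by
  subst hη hI hL hM
  subst a₁ a₂ b₁ b₂
  ext x
  simp
  exact (conj_eqToHom_iff_heq' _ _ _ _).mpr HEq.rfl

/-- **The whisker law of the glued homotopies, log part, on images** (Def. 3.5 (ii) for pairs into `𝒩`,
right whisker trivial): for `r : c₀ → a₀`, `(p, q)` a `𝒟_{≤3}`-pair into `𝒩` whose image is glued,
`ζ_{(r∘p∘∅, r∘q∘∅)} = 𝒟_r ◁ (ζ_{(p,q)} ▷ 𝒟_∅)` up to `eqToHom`s.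
[cite: MochizukiAbsTopIII2015, Corollary 3.6 (iii) p.81] -/
theorem glueη_whisker_mapPath (H₃ : Δ.sub3.HomotopyFamily)
    (hgen : HomotopyFamily.IsGeneratedBy _ H₃ Δ.LogGen)
    {c₀ a₀ : logObsShape.{u}.Vertex} (r : Path c₀ a₀) (p q : Path a₀ lvObs)
    (h : Δ.GlueE (embLog.mapPath p) (embLog.mapPath q)) (hh : H₃.E p q)
    (h' : Δ.GlueE ((embLog.mapPath r).comp ((embLog.mapPath p).comp Path.nil))
      ((embLog.mapPath r).comp ((embLog.mapPath q).comp Path.nil)))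
    (X : Δ.diagram.pathFunctor ((embLog.mapPath r).comp ((embLog.mapPath p).comp Path.nil)) =
      Δ.diagram.pathFunctor (embLog.mapPath r) ⋙ (Δ.diagram.pathFunctor (embLog.mapPath p) ⋙
        Δ.diagram.pathFunctor (Path.nil : Path LFVertex.third LFVertex.third)))
    (Y : Δ.diagram.pathFunctor (embLog.mapPath r) ⋙ (Δ.diagram.pathFunctor (embLog.mapPath q) ⋙
        Δ.diagram.pathFunctor (Path.nil : Path LFVertex.third LFVertex.third)) =
      Δ.diagram.pathFunctor ((embLog.mapPath r).comp ((embLog.mapPath q).comp Path.nil))) :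
    Δ.glueη H₃ hgen h' =
      eqToHom X ≫ Functor.whiskerLeft (Δ.diagram.pathFunctor (embLog.mapPath r))
        (Functor.whiskerRight (Δ.glueη H₃ hgen h) (Δ.diagram.pathFunctor Path.nil)) ≫ eqToHom Y := by
  have hP : (embLog.mapPath r).comp ((embLog.mapPath p).comp Path.nil) = embLog.mapPath (r.comp p) := by
    rw [Path.comp_nil, Prefunctor.mapPath_comp]
  have hQ : (embLog.mapPath r).comp ((embLog.mapPath q).comp Path.nil) = embLog.mapPath (r.comp q) := by
    rw [Path.comp_nil, Prefunctor.mapPath_comp]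
  have h'' : Δ.GlueE (embLog.mapPath (r.comp p)) (embLog.mapPath (r.comp q)) := hP ▸ hQ ▸ h'
  exact whisker_log_case (Δ.diagram.pathFunctor (embLog.mapPath r)) (Δ.glueη_mapPath H₃ hgen p q h hh)
    (Δ.diagram.pathFunctor_nil LFVertex.third) (Δ.glueη_congr H₃ hgen hP hQ h' h'')
    ((Δ.glueη_mapPath H₃ hgen (r.comp p) (r.comp q) h'' (H₃.isSaturated.precomp hh r)).trans
      (Δ.pushLogη_precomp H₃ r hh)) X Y

/-- Transport of a `Saturation LogGen` membership along equal paths (bookkeeping; by substitution).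
[cite: MochizukiAbsTopIII2015, Corollary 3.6 (iii) p.81] -/
theorem saturation_transport {a₀ b₀ : logObsShape.{u}.Vertex} {p p' q q' : Path a₀ b₀}
    (hp : p' = p) (hq : q' = q) (hs : Saturation Δ.LogGen p' q') : Saturation Δ.LogGen p q := by
  subst hp hq
  exact hs

/-- The `𝒟_{≤3}`-pair under a glued image pair lies in `E_{H₃}` (the lift of `embLog[p]` is `p`).
[cite: MochizukiAbsTopIII2015, Corollary 3.6 (iii) p.81] -/
theorem logE_of_glueE_mapPath (H₃ : Δ.sub3.HomotopyFamily)
    (hgen : HomotopyFamily.IsGeneratedBy _ H₃ Δ.LogGen) {a₀ : logObsShape.{u}.Vertex}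
    (p q : Path a₀ lvObs) (h : Δ.GlueE (embLog.mapPath p) (embLog.mapPath q)) : H₃.E p q := by
  have hs := Δ.saturation_of_glueE_third h
  rcases a₀ with ⟨v, hv⟩ | _
  · rcases v with n | _ | _ | _ | _ | _
    · have e₁ : liftLogPath.{u} (embLog.mapPath p) le_rfl = p := eq_of_heq (liftLogPath_mapPath.{u} p le_rfl)
      have e₂ : liftLogPath.{u} (embLog.mapPath q) le_rfl = q := eq_of_heq (liftLogPath_mapPath.{u} q le_rfl)
      exact (hgen p q).mpr (Δ.saturation_transport e₁ e₂ hs)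
    · have e₁ : liftLogPath.{u} (embLog.mapPath p) le_rfl = p := eq_of_heq (liftLogPath_mapPath.{u} p le_rfl)
      have e₂ : liftLogPath.{u} (embLog.mapPath q) le_rfl = q := eq_of_heq (liftLogPath_mapPath.{u} q le_rfl)
      exact (hgen p q).mpr (Δ.saturation_transport e₁ e₂ hs)
    · exact absurd hv (by simp [LFVertex.row])
    · exact absurd hv (by simp [LFVertex.row])
    · exact absurd hv (by simp [LFVertex.row])
    · exact absurd hv (by simp [LFVertex.row])
  · have e₁ : liftLogPath.{u} (embLog.mapPath p) le_rfl = p := eq_of_heq (liftLogPath_mapPath.{u} p le_rfl)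
    have e₂ : liftLogPath.{u} (embLog.mapPath q) le_rfl = q := eq_of_heq (liftLogPath_mapPath.{u} q le_rfl)
    exact (hgen p q).mpr (Δ.saturation_transport e₁ e₂ hs)

/-- **The whisker law of the glued homotopies** (Def. 3.5 (ii): `ζ_{(γ₃∘γ∘γ₄, γ₃∘γ'∘γ₄)} =
𝒟_{γ₄} ◁ ζ_{(γ,γ')} ▷ 𝒟_{γ₃}`), GIVEN the cross-term identity `hcross` for a log pair post-whiskered into a
core vertex: the remaining cases are the universal family over `ℰ` (pairs into rows 4–6) and the
pushed-forward `𝔖_log` family with trivial right whisker (pairs into `𝒩`).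
[cite: MochizukiAbsTopIII2015, Definition 3.5 (ii) p.75] -/
theorem glueη_whisker (H₃ : Δ.sub3.HomotopyFamily) (hgen : HomotopyFamily.IsGeneratedBy _ H₃ Δ.LogGen)
    (hcross : ∀ ⦃a c d : LFVertex⦄ ⦃P Q : Path a LFVertex.third⦄ (h : Δ.GlueE P Q) (r₁ : Path c a)
      (r₂ : Path LFVertex.third d), coreVertices d →
      Δ.glueη H₃ hgen (Δ.isSaturated_glueE.precomp (Δ.isSaturated_glueE.postcomp h r₂) r₁) =
        eqToHom (by rw [pathFunctor_comp, pathFunctor_comp]) ≫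
          Functor.whiskerLeft (Δ.diagram.pathFunctor r₁)
            (Functor.whiskerRight (Δ.glueη H₃ hgen h) (Δ.diagram.pathFunctor r₂)) ≫
          eqToHom (by rw [pathFunctor_comp, pathFunctor_comp]))
    ⦃a b c d : LFVertex⦄ ⦃P Q : Path a b⦄ (h : Δ.GlueE P Q) (r₁ : Path c a) (r₂ : Path b d) :
    Δ.glueη H₃ hgen (Δ.isSaturated_glueE.precomp (Δ.isSaturated_glueE.postcomp h r₂) r₁) =
      eqToHom (by rw [pathFunctor_comp, pathFunctor_comp]) ≫
        Functor.whiskerLeft (Δ.diagram.pathFunctor r₁)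
          (Functor.whiskerRight (Δ.glueη H₃ hgen h) (Δ.diagram.pathFunctor r₂)) ≫
        eqToHom (by rw [pathFunctor_comp, pathFunctor_comp]) := by
  rcases b with _ | _ | _ | _ | _ | _
  · exact (Δ.glueE_false_of_row_le_two (by simp [LFVertex.row]) h).elim
  · exact (Δ.glueE_false_of_row_le_two (by simp [LFVertex.row]) h).elim
  · -- pairs into `𝒩`
    rcases d with _ | _ | _ | _ | _ | _
    · exact absurd (LFVertex.row_le_of_path r₂) (by simp [LFVertex.row])
    · exact absurd (LFVertex.row_le_of_path r₂) (by simp [LFVertex.row])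
    · -- right whisker `𝒩 → 𝒩` is trivial: the `𝔖_log` whisker law
      obtain rfl : r₂ = Path.nil := path_third_third_eq_nil r₂
      rcases a with n | _ | _ | _ | _ | _
      · -- a = row1
        rcases c with m | _ | _ | _ | _ | _
        · obtain ⟨p, rfl⟩ : ∃ p : Path (lvRow1 n) lvObs, embLog.mapPath p = P :=
            ⟨_, eq_of_heq (embLog_mapPath_liftLogPath.{u} P le_rfl)⟩
          obtain ⟨q, rfl⟩ : ∃ q : Path (lvRow1 n) lvObs, embLog.mapPath q = Q :=
            ⟨_, eq_of_heq (embLog_mapPath_liftLogPath.{u} Q le_rfl)⟩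
          obtain ⟨r, rfl⟩ : ∃ r : Path (lvRow1 m) (lvRow1 n), embLog.mapPath r = r₁ :=
            ⟨_, eq_of_heq (embLog_mapPath_liftLogPath.{u} r₁ (by simp [LFVertex.row]))⟩
          exact Δ.glueη_whisker_mapPath H₃ hgen r p q h (Δ.logE_of_glueE_mapPath H₃ hgen p q h) _ _ _
        · exact absurd (LFVertex.row_le_of_path r₁) (by simp [LFVertex.row])
        · exact absurd (LFVertex.row_le_of_path r₁) (by simp [LFVertex.row])
        · exact absurd (LFVertex.row_le_of_path r₁) (by simp [LFVertex.row])
        · exact absurd (LFVertex.row_le_of_path r₁) (by simp [LFVertex.row])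
        · exact absurd (LFVertex.row_le_of_path r₁) (by simp [LFVertex.row])
      · -- a = nexus
        rcases c with m | _ | _ | _ | _ | _
        · obtain ⟨p, rfl⟩ : ∃ p : Path (lvNexus) lvObs, embLog.mapPath p = P :=
            ⟨_, eq_of_heq (embLog_mapPath_liftLogPath.{u} P le_rfl)⟩
          obtain ⟨q, rfl⟩ : ∃ q : Path (lvNexus) lvObs, embLog.mapPath q = Q :=
            ⟨_, eq_of_heq (embLog_mapPath_liftLogPath.{u} Q le_rfl)⟩
          obtain ⟨r, rfl⟩ : ∃ r : Path (lvRow1 m) (lvNexus), embLog.mapPath r = r₁ :=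
            ⟨_, eq_of_heq (embLog_mapPath_liftLogPath.{u} r₁ (by simp [LFVertex.row]))⟩
          exact Δ.glueη_whisker_mapPath H₃ hgen r p q h (Δ.logE_of_glueE_mapPath H₃ hgen p q h) _ _ _
        · obtain ⟨p, rfl⟩ : ∃ p : Path (lvNexus) lvObs, embLog.mapPath p = P :=
            ⟨_, eq_of_heq (embLog_mapPath_liftLogPath.{u} P le_rfl)⟩
          obtain ⟨q, rfl⟩ : ∃ q : Path (lvNexus) lvObs, embLog.mapPath q = Q :=
            ⟨_, eq_of_heq (embLog_mapPath_liftLogPath.{u} Q le_rfl)⟩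
          obtain ⟨r, rfl⟩ : ∃ r : Path (lvNexus) (lvNexus), embLog.mapPath r = r₁ :=
            ⟨_, eq_of_heq (embLog_mapPath_liftLogPath.{u} r₁ (by simp [LFVertex.row]))⟩
          exact Δ.glueη_whisker_mapPath H₃ hgen r p q h (Δ.logE_of_glueE_mapPath H₃ hgen p q h) _ _ _
        · exact absurd (LFVertex.row_le_of_path r₁) (by simp [LFVertex.row])
        · exact absurd (LFVertex.row_le_of_path r₁) (by simp [LFVertex.row])
        · exact absurd (LFVertex.row_le_of_path r₁) (by simp [LFVertex.row])
        · exact absurd (LFVertex.row_le_of_path r₁) (by simp [LFVertex.row])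
      · -- a = third
        rcases c with m | _ | _ | _ | _ | _
        · obtain ⟨p, rfl⟩ : ∃ p : Path (lvObs) lvObs, embLog.mapPath p = P :=
            ⟨_, eq_of_heq (embLog_mapPath_liftLogPath.{u} P le_rfl)⟩
          obtain ⟨q, rfl⟩ : ∃ q : Path (lvObs) lvObs, embLog.mapPath q = Q :=
            ⟨_, eq_of_heq (embLog_mapPath_liftLogPath.{u} Q le_rfl)⟩
          obtain ⟨r, rfl⟩ : ∃ r : Path (lvRow1 m) (lvObs), embLog.mapPath r = r₁ :=
            ⟨_, eq_of_heq (embLog_mapPath_liftLogPath.{u} r₁ le_rfl)⟩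
          exact Δ.glueη_whisker_mapPath H₃ hgen r p q h (Δ.logE_of_glueE_mapPath H₃ hgen p q h) _ _ _
        · obtain ⟨p, rfl⟩ : ∃ p : Path (lvObs) lvObs, embLog.mapPath p = P :=
            ⟨_, eq_of_heq (embLog_mapPath_liftLogPath.{u} P le_rfl)⟩
          obtain ⟨q, rfl⟩ : ∃ q : Path (lvObs) lvObs, embLog.mapPath q = Q :=
            ⟨_, eq_of_heq (embLog_mapPath_liftLogPath.{u} Q le_rfl)⟩
          obtain ⟨r, rfl⟩ : ∃ r : Path (lvNexus) (lvObs), embLog.mapPath r = r₁ :=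
            ⟨_, eq_of_heq (embLog_mapPath_liftLogPath.{u} r₁ le_rfl)⟩
          exact Δ.glueη_whisker_mapPath H₃ hgen r p q h (Δ.logE_of_glueE_mapPath H₃ hgen p q h) _ _ _
        · obtain ⟨p, rfl⟩ : ∃ p : Path (lvObs) lvObs, embLog.mapPath p = P :=
            ⟨_, eq_of_heq (embLog_mapPath_liftLogPath.{u} P le_rfl)⟩
          obtain ⟨q, rfl⟩ : ∃ q : Path (lvObs) lvObs, embLog.mapPath q = Q :=
            ⟨_, eq_of_heq (embLog_mapPath_liftLogPath.{u} Q le_rfl)⟩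
          obtain ⟨r, rfl⟩ : ∃ r : Path (lvObs) (lvObs), embLog.mapPath r = r₁ :=
            ⟨_, eq_of_heq (embLog_mapPath_liftLogPath.{u} r₁ le_rfl)⟩
          exact Δ.glueη_whisker_mapPath H₃ hgen r p q h (Δ.logE_of_glueE_mapPath H₃ hgen p q h) _ _ _
        · exact absurd (LFVertex.row_le_of_path r₁) (by simp [LFVertex.row])
        · exact absurd (LFVertex.row_le_of_path r₁) (by simp [LFVertex.row])
        · exact absurd (LFVertex.row_le_of_path r₁) (by simp [LFVertex.row])
      · exact (false_of_path_to_third (by decide) P).elim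
      · exact (false_of_path_to_third (by decide) P).elim
      · exact (false_of_path_to_third (by decide) P).elim
    · exact hcross h r₁ r₂ (Or.inl rfl)
    · exact hcross h r₁ r₂ (Or.inr (Or.inl rfl))
    · exact hcross h r₁ r₂ (Or.inr (Or.inr rfl))
  · -- pairs into row 4 (universal family over `ℰ`)
    rcases d with _ | _ | _ | _ | _ | _
    · exact absurd (LFVertex.row_le_of_path r₂) (by simp [LFVertex.row])
    · exact absurd (LFVertex.row_le_of_path r₂) (by simp [LFVertex.row])
    · exact absurd (LFVertex.row_le_of_path r₂) (by simp [LFVertex.row])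
    · exact Δ.coresFamily.η_whisker (Δ.univE_of_glueE (by decide) h) r₁ r₂
    · exact Δ.coresFamily.η_whisker (Δ.univE_of_glueE (by decide) h) r₁ r₂
    · exact Δ.coresFamily.η_whisker (Δ.univE_of_glueE (by decide) h) r₁ r₂
  · -- pairs into row 5
    rcases d with _ | _ | _ | _ | _ | _
    · exact absurd (LFVertex.row_le_of_path r₂) (by simp [LFVertex.row])
    · exact absurd (LFVertex.row_le_of_path r₂) (by simp [LFVertex.row])
    · exact absurd (LFVertex.row_le_of_path r₂) (by simp [LFVertex.row])
    · exact absurd (LFVertex.row_le_of_path r₂) (by simp [LFVertex.row])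
    · exact Δ.coresFamily.η_whisker (Δ.univE_of_glueE (by decide) h) r₁ r₂
    · exact Δ.coresFamily.η_whisker (Δ.univE_of_glueE (by decide) h) r₁ r₂
  · -- pairs into row 6
    rcases d with _ | _ | _ | _ | _ | _
    · exact absurd (LFVertex.row_le_of_path r₂) (by simp [LFVertex.row])
    · exact absurd (LFVertex.row_le_of_path r₂) (by simp [LFVertex.row])
    · exact absurd (LFVertex.row_le_of_path r₂) (by simp [LFVertex.row])
    · exact absurd (LFVertex.row_le_of_path r₂) (by simp [LFVertex.row])
    · exact absurd (LFVertex.row_le_of_path r₂) (by simp [LFVertex.row])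
    · exact Δ.coresFamily.η_whisker (Δ.univE_of_glueE (by decide) h) r₁ r₂

/-! ### §3 (abc-iut-w5-d053, gen 3): the master family, its `𝔖_log`-compatibility, the cores, and Cor 3.6 (iii) -/

/-- On a pair into a CORE vertex (rows 4–6) the glued homotopy is the universal homotopy over `ℰ`
(`coresFamily.η`) — the unfolding the cross-term sequel («Cor36-CROSS», abc-iut-L4-t5) rewrites with.
[cite: MochizukiAbsTopIII2015, Corollary 3.6 (i) p.80] -/
theorem glueη_of_coreVertices (H₃ : Δ.sub3.HomotopyFamily)
    (hgen : HomotopyFamily.IsGeneratedBy _ H₃ Δ.LogGen) {a b : LFVertex} (hb : coreVertices b)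
    {P Q : Path a b} (h : Δ.GlueE P Q) :
    Δ.glueη H₃ hgen h = Δ.coresFamily.η (Δ.univE_of_glueE (by rcases hb with rfl | rfl | rfl <;> decide) h) := by
  rcases hb with rfl | rfl | rfl <;> rfl


/-- **The MASTER FAMILY of homotopies on `𝒟`** (blueprint of abc-iut-L4-t5, Cor. 3.6 (iii) proof p. 81):
boundary set the glued set `E_W ∪ E_log` (`GlueE`), homotopies `glueη` (universal over `ℰ` on pairs into
rows 4–6, pushed-forward `𝔖_log` homotopies on pairs into `𝒩`), GIVEN the cross-term identity `hcross`
(the whisker law for a log pair post-whiskered into a core vertex — the gluing condition; its content is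
`IotaOverGaloisStmt` on the type-(1)/(2) generators extended over `Sat(LogGen)`).
[cite: MochizukiAbsTopIII2015, Corollary 3.6 (iii) p.81] -/
noncomputable def glueFamily (H₃ : Δ.sub3.HomotopyFamily)
    (hgen : HomotopyFamily.IsGeneratedBy _ H₃ Δ.LogGen)
    (hcross : ∀ ⦃a c d : LFVertex⦄ ⦃P Q : Path a LFVertex.third⦄ (h : Δ.GlueE P Q) (r₁ : Path c a)
      (r₂ : Path LFVertex.third d), coreVertices d →
      Δ.glueη H₃ hgen (Δ.isSaturated_glueE.precomp (Δ.isSaturated_glueE.postcomp h r₂) r₁) =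
        eqToHom (by rw [pathFunctor_comp, pathFunctor_comp]) ≫
          Functor.whiskerLeft (Δ.diagram.pathFunctor r₁)
            (Functor.whiskerRight (Δ.glueη H₃ hgen h) (Δ.diagram.pathFunctor r₂)) ≫
          eqToHom (by rw [pathFunctor_comp, pathFunctor_comp])) :
    Δ.diagram.HomotopyFamily where
  E := Δ.GlueE
  isSaturated := Δ.isSaturated_glueE
  η := fun _ _ _ _ h => Δ.glueη H₃ hgen h
  η_refl := fun _ _ _ h => Δ.glueη_refl H₃ hgen h
  η_trans := fun _ _ _ _ _ h₁ h₂ => Δ.glueη_trans H₃ hgen h₁ h₂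
  η_whisker := fun _ _ _ _ _ _ h r₁ r₂ => Δ.glueη_whisker H₃ hgen hcross h r₁ r₂

/-- The `𝔖_log` homotopy is (heterogeneously) its push-forward to `𝒟`.
[cite: MochizukiAbsTopIII2015, Definition 3.5 (ii) p.75] -/
theorem heq_pushLogη (H₃ : Δ.sub3.HomotopyFamily) {a₀ b₀ : logObsShape.{u}.Vertex} {p q : Path a₀ b₀}
    (h : H₃.E p q) : HEq (H₃.η h) (Δ.pushLogη H₃ h) := by
  unfold pushLogη
  exact ((DiagramOfCategories.HomotopyFamily.heq_eqToHom_comp_comp_eqToHom _ _ _).trans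
    (HomotopyFamily.cast_η_heq Δ.sub3_eq_comapAlong H₃ _)).symm

/-- The image of an `E_{H₃}` pair into `𝒩` is a glued pair (a log pair).
[cite: MochizukiAbsTopIII2015, Corollary 3.6 (iii) p.81] -/
theorem glueE_mapPath_of_logE (H₃ : Δ.sub3.HomotopyFamily)
    (hgen : HomotopyFamily.IsGeneratedBy _ H₃ Δ.LogGen) {a₀ : logObsShape.{u}.Vertex}
    (p q : Path a₀ lvObs) (hh : H₃.E p q) : Δ.GlueE (embLog.mapPath p) (embLog.mapPath q) := by
  have hs := (hgen p q).mp hh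
  rcases a₀ with ⟨v, hv⟩ | _
  · rcases v with n | _ | _ | _ | _ | _
    · exact GlueE.log (Δ.saturation_transport (eq_of_heq (liftLogPath_mapPath.{u} p le_rfl)).symm
        (eq_of_heq (liftLogPath_mapPath.{u} q le_rfl)).symm hs)
    · exact GlueE.log (Δ.saturation_transport (eq_of_heq (liftLogPath_mapPath.{u} p le_rfl)).symm
        (eq_of_heq (liftLogPath_mapPath.{u} q le_rfl)).symm hs)
    · exact absurd hv (by simp [LFVertex.row])
    · exact absurd hv (by simp [LFVertex.row])
    · exact absurd hv (by simp [LFVertex.row])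
    · exact absurd hv (by simp [LFVertex.row])
  · exact GlueE.log (Δ.saturation_transport (eq_of_heq (liftLogPath_mapPath.{u} p le_rfl)).symm
      (eq_of_heq (liftLogPath_mapPath.{u} q le_rfl)).symm hs)

variable {Δ} in
/-- **The `𝔖_log` family is compatible, along `𝒟_{≤3} ↪ 𝒟`, with the master family** (Def. 3.5 (ii):
`E_{𝔖_log} ⊆ E_K` and the same homotopies) — the log half of `RealisesCoresAndLogObs`, taken with the
given `𝔖_log` family itself. [cite: MochizukiAbsTopIII2015, Corollary 3.6 (iii) p.80] -/
theorem compatibleAlong_embLog_glueFamily {H₃ : Δ.sub3.HomotopyFamily} (hH₃ : Δ.IsLogObservableFamily H₃)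
    (hcross : ∀ ⦃a c d : LFVertex⦄ ⦃P Q : Path a LFVertex.third⦄ (h : Δ.GlueE P Q) (r₁ : Path c a)
      (r₂ : Path LFVertex.third d), coreVertices d →
      Δ.glueη H₃ hH₃.1 (Δ.isSaturated_glueE.precomp (Δ.isSaturated_glueE.postcomp h r₂) r₁) =
        eqToHom (by rw [pathFunctor_comp, pathFunctor_comp]) ≫
          Functor.whiskerLeft (Δ.diagram.pathFunctor r₁)
            (Functor.whiskerRight (Δ.glueη H₃ hH₃.1 h) (Δ.diagram.pathFunctor r₂)) ≫
          eqToHom (by rw [pathFunctor_comp, pathFunctor_comp])) :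
    H₃.CompatibleAlong embLog (Δ.glueFamily H₃ hH₃.1 hcross) := by
  intro a₀ b₀ p q h
  have hb : b₀ = lvObs := hH₃.2.1 h
  subst hb
  exact ⟨Δ.glueE_mapPath_of_logE H₃ hH₃.1 p q h,
    (Δ.heq_pushLogη H₃ h).trans (heq_of_eq (Δ.glueη_mapPath H₃ hH₃.1 p q _ h).symm)⟩

variable {Δ} in
/-- **[AbsTopIII] Cor 3.6 (iii), second clause (cores) — REDUCED TO THE CROSS-TERM IDENTITY.**  Given the
`𝔖_log` family `H₃` on `𝒟_{≤3}` (it exists for every `𝒟`: abc-iut-w4-d095's `observableLogStmt`) and the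
cross-term gluing identity `hcross` for the glued homotopies, ONE family of homotopies on `𝒟` — the master
family — contains the `𝔖_log` family and core families for `(𝒟_{≤4}, ℰ)`, `(𝒟_{≤5}, Anab)`, `(𝒟_{≤6}, ℰ)`:
`LogObsCompatCoresStmt`.  HONEST SCOPE: `hcross` is the ONLY hypothesis; its content is the whisker law for
a log pair post-composed into a core vertex, i.e. `IotaOverGaloisStmt` (F-0360; PROVED AT THE MODEL,
`TFModel.iotaOverGaloisStmt_model`) on the type-(1)/(2) generators extended over `Sat(LogGen)` — not
discharged here. [cite: MochizukiAbsTopIII2015, Corollary 3.6 (iii) p.80] -/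
theorem logObsCompatCoresStmt_of_glueCross {H₃ : Δ.sub3.HomotopyFamily} (hH₃ : Δ.IsLogObservableFamily H₃)
    (hcross : ∀ ⦃a c d : LFVertex⦄ ⦃P Q : Path a LFVertex.third⦄ (h : Δ.GlueE P Q) (r₁ : Path c a)
      (r₂ : Path LFVertex.third d), coreVertices d →
      Δ.glueη H₃ hH₃.1 (Δ.isSaturated_glueE.precomp (Δ.isSaturated_glueE.postcomp h r₂) r₁) =
        eqToHom (by rw [pathFunctor_comp, pathFunctor_comp]) ≫
          Functor.whiskerLeft (Δ.diagram.pathFunctor r₁)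
            (Functor.whiskerRight (Δ.glueη H₃ hH₃.1 h) (Δ.diagram.pathFunctor r₂)) ≫
          eqToHom (by rw [pathFunctor_comp, pathFunctor_comp])) :
    Δ.LogObsCompatCoresStmt := by
  let K := Δ.glueFamily H₃ hH₃.1 hcross
  have h₄ : (Δ.coreObs4 (Δ.coreFamily4Of K) (fun _ _ _ _ h => h.1)).IsCore :=
    ⟨fun _ p q => ⟨rfl, (Δ.pullCore4_E_iff K p q).mpr (GlueE.univ
        (univE_of_mem coreVertices (Or.inl rfl) (embCore4.mapPath p) (embCore4.mapPath q)))⟩, reaches4⟩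
  have h₅ : (Δ.coreObs5 (Δ.coreFamily5Of K) (fun _ _ _ _ h => h.1)).IsCore :=
    ⟨fun _ p q => ⟨rfl, (Δ.pullCore5_E_iff K p q).mpr (GlueE.univ
        (univE_of_mem coreVertices (Or.inr (Or.inl rfl)) (embCore5.mapPath p) (embCore5.mapPath q)))⟩,
      reaches5⟩
  have h₆ : (Δ.coreObs6 (Δ.coreFamily6Of K) (fun _ _ _ _ h => h.1)).IsCore :=
    ⟨fun _ p q => ⟨rfl, (Δ.pullCore6_E_iff K p q).mpr (GlueE.univ
        (univE_of_mem coreVertices (Or.inr (Or.inr rfl)) (embCore6.mapPath p) (embCore6.mapPath q)))⟩,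
      reaches6⟩
  exact ⟨K, ⟨H₃, hH₃, compatibleAlong_embLog_glueFamily hH₃ hcross⟩,
    ⟨_, _, h₄, HomotopyFamily.endingAt_compatibleAlong _ _ _ (Δ.pullCore4_compatibleAlong K) _ _⟩,
    ⟨_, _, h₅, HomotopyFamily.endingAt_compatibleAlong _ _ _ (Δ.pullCore5_compatibleAlong K) _ _⟩,
    ⟨_, _, h₆, HomotopyFamily.endingAt_compatibleAlong _ _ _ (Δ.pullCore6_compatibleAlong K) _ _⟩⟩

end LogFrobeniusData

end Literature.AnabelianGeometry.AbsoluteAnabelian
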